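import Literature.NumberTheory.Rogawski1990.ArchEPAssemblyDefiniteSlots         -- (12′) E2a (this brick): `sum_partnerPerms_chartOrbG_eq_card_mul_sum_restrict` (the `6^{#D}` collapse); brings ★ FILE P
import Literature.NumberTheory.Rogawski1990.ArchChartOrbGIsolateFinset          -- ★ (F′) (F0P3a-p05 (g21)) :242 `chartOrbG_eq_prod_mul_integral_pi_group_isolate_of_forall_not_mem` (the `D`-block as WHOLE-GROUP `U(3)` integrals)
import HarnessLib

/-!
# EP ASSEMBLY, DEFINITE PLACES II: the `α`-side partner sum at an admissible label, CLOSED FORM — `6^{#D}` times the partner sum over the indefinite block of the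
# `D`-isolated reading (whole-group `U(3)^D` integral of the partial chart-orbital integral over the other places) (N8-INNER ROAD B, brick (12′) E2b; Rogawski 1990 §4.1, §8.2–8.3; Folland §2.6)

Topic `NumberTheory/Rogawski1990`; namespace `Literature.NumberTheory.Rogawski1990`.  THEOREMS ONLY (no `def`, no instance, no notation, no axiom, no named fact, no `sorry`).  Cell
`pub/hodgecm-mathlib`, crux H413 (`stmt-HodgeConjecture-24833`), F0∕P3c road «N8-INNER» ROAD B, brick (12′) «EP ASSEMBLY» FILE E2b (census `F0/P3c/LH7/LH7-p01/g7/ep/CENSUS-N8-brick12EP.v1.LH7p01g7.md`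
4b6e6521d5d67659 §4, `G′`-SIDE; holder LH7-p01 (g7), statement; proof bridge LH3-p03 (g8): the explicit subtype-`Fintype` binders of ★ :242 are
SUBSTITUTED by the inferred instances (`Subsingleton.elim`) before E2a is rewritten).  Count-neutral.

THE MATHEMATICS.  `G′_∞ = U(diag α)(L⁺ ⊗ ℝ)` in PRODUCT-MEASURE form (`ν′ = e⁻¹⁎ ⊗_w ν′_w`, the `hν` binder of ★ (A1)∕(J-iso)), `D = {p}` a block of `α`-DEFINITE places (`p w → w ∉ splitChartPlaces L α`),
`S′` admissible (so `S′ ∩ D = ∅`), `c ∈ RegG S′`, `a′ ∈ C_c(G′_∞)`.  The `α`-side of H-S4′ at `(S′, c)` is `κ · R′_{S′}(c) · Σ_{ρ ∈ partnerPerms S′} chartOrbG ν′ S′ a′ (ρ·c)` (★ READ-G ∕ ★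
`stableSumG_eq_archRG_mul_sum`); here the partner sum is put in CLOSED FORM:
**`sum_partnerPerms_chartOrbG_eq_card_mul_sum_integral_pi_group`**:
`Σ_{ρ ∈ partnerPerms S′} chartOrbG ν′ S′ a′ (ρ·c) = 6^{#D} · Σ_{ρ₂ ∈ partnerPerms S′|_I} (Π_{w∈I} t_w(B′_w)) · ∫_{g ∈ Π_D U(α)_w} ∫_{Π_I (U_w ⧸ T′_w)} a′ (e⁻¹ (g γ_D((1⊔ρ₂)·c) g⁻¹, (ḃ γ_I((1⊔ρ₂)·c) ḃ⁻¹)_I))`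
— E2a (every `D`-slot permutation is realised in `U(3)`: `6^{#D}` equal terms) followed by ★ (F′) :242 at each regular partner point (★ `slotPerm_mem_regG_iff`); the `D`-box factors are GONE
(cancelled against `t_w(T′_w)`), only the `I`-box factors `Π_{w∈I} t_w(B′_w)` survive (census §4 «BOX MASSES»).  The `β`-side twin (tensor families, ★ p852031 + (F1′)) and the Fubini producing
the lambda `Ā_{a′}(x_D, ·) = ∫_{U(3)^D} a′(e⁻¹(k x_D k⁻¹, ·)) dk` are E3's first lines ((GT) hands `Ā = Ã ∘ cl_D`).
HONEST LABEL: HC_CM is proved only modulo the 7 printed citations (2 remaining: hLiu418 = `stmt-HodgeConjecture-24832`, h413 = `stmt-HodgeConjecture-24833`) until rung 0 closes; count-neutral until the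
junction payer is ★ and ED. 43 re-keys 27456 6 → 5.

## References
* [Rogawski1990] J. D. Rogawski, *Automorphic Representations of Unitary Groups in Three Variables*, Ann. of Math. Stud. 123 (1990), §4.1 (4.1.1) p. 39, §8.2 p. 122, §8.3 p. 124, §3.6 p. 28.
* [Folland1995] G. B. Folland, *A Course in Abstract Harmonic Analysis* (1995), §2.2; §2.6 Thm. 2.49, (2.52).
* [Shelstad1979] D. Shelstad, *Characters and inner forms of a quasi-split group over ℝ*, Compositio Math. 39 (1979), §4 p. 22, Lemma 4.2 p. 23.
* [BorelJacquet1979] A. Borel, H. Jacquet, *Automorphic forms and automorphic representations*, PSPM 33.1 (1979), §4.1.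
-/

set_option autoImplicit false

noncomputable section

open MeasureTheory MeasureTheory.Measure NumberField NumberField.InfinitePlace Matrix Complex Topology
open Literature.MeasureTheory.Group Literature.NumberTheory.Automorphic Literature.NumberTheory.Automorphic.UnitaryGroup Literature.NumberTheory.Automorphic.ArchCartan
open scoped MatrixGroups Matrix Classical ENNReal NNReal

namespace Literature.NumberTheory.Rogawski1990

section DefiniteClosedForm

variable (L : Type) [Field L] [NumberField L] [IsCMField L] (α : Fin 3 → L) (S' : Finset {w : InfinitePlace L // IsComplex w})
  [∀ w : {w : InfinitePlace L // IsComplex w}, MeasurableSpace ↥(archLocal L 3 (Matrix.diagonal α) w)]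
  [∀ w : {w : InfinitePlace L // IsComplex w}, BorelSpace ↥(archLocal L 3 (Matrix.diagonal α) w)]
  -- ★ `locallyCompactSpace_archLocal_three` ∕ ★ `secondCountableTopology_archLocal_three` (theorems, not instances: supplied by the consumer with `haveI`)
  [∀ w : {w : InfinitePlace L // IsComplex w}, LocallyCompactSpace ↥(archLocal L 3 (Matrix.diagonal α) w)]
  [∀ w : {w : InfinitePlace L // IsComplex w}, SecondCountableTopology ↥(archLocal L 3 (Matrix.diagonal α) w)]
  [MeasurableSpace ↥(arch (↥(maximalRealSubfield L)) L (IsCMField.complexConj L) 3 (Matrix.diagonal α))]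
  [BorelSpace ↥(arch (↥(maximalRealSubfield L)) L (IsCMField.complexConj L) 3 (Matrix.diagonal α))]
  [∀ w : {w : InfinitePlace L // IsComplex w}, MeasurableSpace (↥(archLocal L 3 (Matrix.diagonal α) w) ⧸ chartTorusGLoc L α w S')]
  [∀ w : {w : InfinitePlace L // IsComplex w}, BorelSpace (↥(archLocal L 3 (Matrix.diagonal α) w) ⧸ chartTorusGLoc L α w S')]
  (ν'w : ∀ w : {w : InfinitePlace L // IsComplex w}, Measure ↥(archLocal L 3 (Matrix.diagonal α) w)) [∀ w, (ν'w w).IsHaarMeasure] [∀ w, (ν'w w).IsMulRightInvariant]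
  (ν' : Measure ↥(arch (↥(maximalRealSubfield L)) L (IsCMField.complexConj L) 3 (Matrix.diagonal α))) [ν'.IsHaarMeasure] [ν'.IsMulRightInvariant]
  (hν : ν' = (Measure.pi ν'w).map (archPiEquivCM 3 L (Matrix.diagonal α)).symm)
  (t : ∀ w : {w : InfinitePlace L // IsComplex w}, Measure ↥(chartTorusGLoc L α w S')) [∀ w, (t w).IsHaarMeasure] [∀ w, (t w).IsInvInvariant]
  (p : {w : InfinitePlace L // IsComplex w} → Prop) [DecidablePred p]

omit [IsCMField L] in
/-- The glued relabelling `1 ⊔ ρ₂` (identity on the block `p`, `ρ₂` off it) is a partner relabelling of `S′` when `ρ₂` is one of `S′|_{¬p}` (★ FILE P `mem_partnerPerms_iff_restrict`).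
[cite: Shelstad1979, Lemma 4.2 p. 23] -/
theorem piEquivPiSubtypeProd_symm_one_mem_partnerPerms {ρ₂ : {w : {w : InfinitePlace L // IsComplex w} // ¬ p w} → Equiv.Perm (Fin 3)}
    (hρ₂ : ρ₂ ∈ partnerPerms (S'.subtype fun w => ¬ p w)) :
    (Equiv.piEquivPiSubtypeProd p (fun _ : {w : InfinitePlace L // IsComplex w} => Equiv.Perm (Fin 3))).symm (1, ρ₂) ∈ partnerPerms S' := by
  rw [mem_partnerPerms_iff_restrict p S', restrict_piEquivPiSubtypeProd_symm_fst, restrict_piEquivPiSubtypeProd_symm_snd]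
  exact ⟨(mem_partnerPerms_iff _ _).2 fun _ _ => rfl, hρ₂⟩

variable [Fintype {w : {w : InfinitePlace L // IsComplex w} // p w}] [Fintype {w : {w : InfinitePlace L // IsComplex w} // ¬ p w}]

set_option maxHeartbeats 2000000 in
include hν in
/-- **THE `α`-SIDE PARTNER SUM IN CLOSED FORM (definite block isolated as whole-group integrals)**: for an admissible `S′`, a block `p` of `α`-definite places (`p w → w ∉ splitChartPlaces L α`),
`c ∈ RegG S′`, `a′ ∈ C_c(G′_∞)`, product-measure convention `hν` and any inversion-invariant Haar family `t_w` on the local chart tori: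
`Σ_{ρ ∈ partnerPerms S′} chartOrbG ν′ S′ a′ (ρ·c) = 6^{#p} · Σ_{ρ₂ ∈ partnerPerms S′|_{¬p}} (Π_{¬p} t_w(B′_w)) · ∫_{Π_p U(α)_w} ∫_{Π_{¬p} (U_w ⧸ T′_w)} a′ (e⁻¹ ((g γ_w(ρ′c) g⁻¹)_p, (ḃ γ_w(ρ′c) ḃ⁻¹)_{¬p}))`,
`ρ′ = 1 ⊔ ρ₂` — E2a's `6^{#D}` collapse then ★ (F′) :242 at each regular partner point (★ `slotPerm_mem_regG_iff`).  No `D`-box factor survives.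
[cite: Rogawski1990, §4.1 (4.1.1) p. 39; §8.2 p. 122; §8.3 p. 124] [cite: Folland1995, §2.6 (2.52)] [cite: Shelstad1979, Lemma 4.2 p. 23] [cite: BorelJacquet1979, §4.1] -/
theorem sum_partnerPerms_chartOrbG_eq_card_mul_sum_integral_pi_group (hα : ∀ i, α i ≠ 0) (hherm : ∀ i, (IsCMField.complexConj L (α i) : L) = α i)
    (hS' : ∀ w, w ∈ S' → w ∈ splitChartPlaces L α) (hp : ∀ w, p w → w ∉ splitChartPlaces L α)
    {c : {w : InfinitePlace L // IsComplex w} → Fin 3 → ℝ} (hc : c ∈ ArchCartan.RegG S')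
    {a' : ↥(arch (↥(maximalRealSubfield L)) L (IsCMField.complexConj L) 3 (Matrix.diagonal α)) → ℂ} (ha'c : Continuous a') (ha's : HasCompactSupport a') :
    ∑ ρ ∈ partnerPerms S', chartOrbG L α ν' S' a' (slotPerm ρ c) =
      (6 : ℂ) ^ Fintype.card {w : {w : InfinitePlace L // IsComplex w} // p w} *
        ∑ ρ₂ ∈ partnerPerms (S'.subtype fun w => ¬ p w),
          (∏ w' : {w : {w : InfinitePlace L // IsComplex w} // ¬ p w}, ((t w'.1 (chartBoxImgGLoc L α w'.1 S')).toReal : ℂ)) *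
            ∫ g : (∀ w : {w : {w : InfinitePlace L // IsComplex w} // p w}, ↥(archLocal L 3 (Matrix.diagonal α) w.1)),
              (∫ b : (∀ w' : {w : {w : InfinitePlace L // IsComplex w} // ¬ p w}, ↥(archLocal L 3 (Matrix.diagonal α) w'.1) ⧸ chartTorusGLoc L α w'.1 S'),
                a' ((archPiEquivCM 3 L (Matrix.diagonal α)).symm
                  ((MeasurableEquiv.piEquivPiSubtypeProd (fun w : {w : InfinitePlace L // IsComplex w} => ↥(archLocal L 3 (Matrix.diagonal α) w)) p).symm
                    (fun w => g w * gprimeBlockAt L α w.1 S'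
                        (slotPerm ((Equiv.piEquivPiSubtypeProd p (fun _ : {w : InfinitePlace L // IsComplex w} => Equiv.Perm (Fin 3))).symm (1, ρ₂)) c w.1) * (g w)⁻¹,
                      fun w' => descConj (gprimeBlockAt L α w'.1 S'
                          (slotPerm ((Equiv.piEquivPiSubtypeProd p (fun _ : {w : InfinitePlace L // IsComplex w} => Equiv.Perm (Fin 3))).symm (1, ρ₂)) c w'.1))
                        (chartTorusGLoc L α w'.1 S')
                        (forall_mem_chartTorusGLoc_comm L α w'.1 S'
                          (slotPerm ((Equiv.piEquivPiSubtypeProd p (fun _ : {w : InfinitePlace L // IsComplex w} => Equiv.Perm (Fin 3))).symm (1, ρ₂)) c w'.1))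
                        id (b w'))))
                ∂(Measure.pi fun w' : {w : {w : InfinitePlace L // IsComplex w} // ¬ p w} =>
                    quotientMeasure (chartTorusGLoc L α w'.1 S') (t w'.1) (isClosed_chartTorusGLoc L α w'.1 S') (ν'w w'.1)))
              ∂(Measure.pi fun w : {w : {w : InfinitePlace L // IsComplex w} // p w} => ν'w w.1) := by
  have hpS : ∀ w, p w → w ∉ S' := fun w hw h => hp w hw (hS' w h)
  -- E2a is stated with the INFERRED subtype `Fintype` instances; this theorem carries ★ :242's EXPLICIT `[Fintype …]` binders.  `Fintype _` is a
  -- subsingleton, so we may SUBSTITUTE the explicit instances by the inferred ones before rewriting (then both sides agree syntactically).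
  obtain rfl : ‹Fintype {w : {w : InfinitePlace L // IsComplex w} // p w}› = Subtype.fintype _ := Subsingleton.elim _ _
  obtain rfl : ‹Fintype {w : {w : InfinitePlace L // IsComplex w} // ¬ p w}› = Subtype.fintype _ := Subsingleton.elim _ _
  rw [sum_partnerPerms_chartOrbG_eq_card_mul_sum_restrict L α ν' S' p hα hherm hS' hp a' c]
  congr 1
  refine Finset.sum_congr rfl fun ρ₂ hρ₂ => ?_
  have hρ : (Equiv.piEquivPiSubtypeProd p (fun _ : {w : InfinitePlace L // IsComplex w} => Equiv.Perm (Fin 3))).symm (1, ρ₂) ∈ partnerPerms S' := by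
    refine (mem_partnerPerms_iff S' _).2 fun w hw => ?_
    rw [Equiv.piEquivPiSubtypeProd_symm_apply]
    by_cases hpw : p w
    · exact absurd hw (hpS w hpw)
    · rw [dif_neg hpw]
      exact (mem_partnerPerms_iff _ _).1 hρ₂ ⟨w, hpw⟩ (Finset.mem_subtype.2 hw)
  exact chartOrbG_eq_prod_mul_integral_pi_group_isolate_of_forall_not_mem L α S' ν'w ν' hν t p hα hS' hpS ((slotPerm_mem_regG_iff hρ c).2 hc) ha'c ha's

end DefiniteClosedForm

end Literature.NumberTheory.Rogawski1990

end
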